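import Summits.Ventures.YMGap.Thresholds.TwistedBochnerSU3
import HarnessLib

/-!
# Venture YMGap — the INTEGRATED twisted Bochner inequality on `SU(N)` (every `N ≥ 2`, every twist, every Hessian split)
# and the hypothesis-free one-link Poincaré constant it gives for EVERY `N ≥ 2` beyond Bakry–Émery

HONEST FRAMING.  Venture file of the cell `pub-ymgap` (QuantumFields programme), seat engine-2 (g12); 0 compute.  Explicit
STRONG-COUPLING constants for ONE tilted Haar law `ν_B(dg) ∝ exp(N Re tr(gB)) dg` on `SU(N)` (small-`β` bookkeeping for lattice
Yang–Mills); NOT weak coupling, NOT a continuum statement, NOT a Yang–Mills mass-gap claim.  No sharpness claimed (Haar truth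
`1/λ₁ = N/(N²−1)`); NO `N`-UNIFORM gain claimed (the improvement over Bakry–Émery is `O(1/N²)`, so the every-`N` 't Hooft rows of
`TorusRowsSUNStar` do not move); nothing better than g11's `TwistedBochnerSU3` for `N = 3` or than J-SC13 for `N = 2`.

THE MECHANISM.  g11's pointwise `TwistedBochnerSUN.twisted_bochner` (every `N`, every `θ`) integrated against `e^S dσ`, `S = c Re tr(·B)`,
with the tree's integrations by parts `∫e^S (L_S u)² = ∫e^S Γ₂`, `∫e^S (L_S u)Γ(S,u) = −∫e^S Γ(Γ(S,u),u)`,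
`∫e^S Γ(S,Γ(u,u)) = (N − 1/N)∫e^S SΓ − ∫e^S Γ(S,S)Γ`, and a pointwise Hessian bound `∑ D_αu D_βu D_αD_βS ≤ −(η/N)·S·Γ + κ·Γ`; with
`n = N² − 1`, `a_H = 1 − 2(1−θ)/n`, `a_X = θ − (1−θ)/n` (`integral_twisted_bochner`):
  `(N/2 − a_H κ)∫e^SΓ ≤ (1 − 1/n)∫e^S(L_S u)² + (a_X(N − 1/N) − a_H η/N)∫e^S SΓ + (θ²/2 − a_X)∫e^S Γ(S,S)Γ + (θ²/2 − (1−θ)²/n)∫e^S Γ(S,u)²`.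
g11's `SU(3)` theorem is the instance `θ = 1/5`, `η = 1`, `κ = |c|‖B‖_F/√6`.  THIS FILE'S INSTANCE, every `N ≥ 2`: `θ = 1/N²` (then `a_X = 0`:
the `SΓ` words cancel WITHOUT a Hessian split, `η = 0`), the Bakry–Émery bound `κ = |c|‖B‖_op` (`abs_re_trace_unitary_mul_mul_mul_le`),
`Γ(S,S) ≤ c²‖B‖_F²` (Bessel), the `Γ(S,u)²` slack dropped:
* `integral_exp_mul_Gam_le_twisted_sun`: `((N²−1)/(N²−2))·(N/2 − (1 − 2/N²)|c|‖B‖_op − c²‖B‖_F²/(2N⁴)) ∫e^SΓ ≤ ∫e^S(L_S u)²`;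
* `suN_var_tilted_le_twisted`, ★ `oneLinkPoincareSUN_twisted`: `OneLinkPoincareSUN N R (1/K)` whenever `0 < K` and
  `K + ((N²−1)/N)R + ((N²−1)/(2N(N²−2)))R² ≤ N(N²−1)/(2(N²−2))`.  Against Bakry–Émery's `K = N(1/2 − R)`, `R < 1/2`
  (`oneLinkPoincareSUN_bakryEmery`): intercept `× (N²−1)/(N²−2)` (Lichnerowicz), slope `N → N − 1/N`; larger at every `N`, `R`, and the
  radius cap moves to `√((N²−2)² + N²) − (N²−2) > 1/2` (`SU(4)` 0.560, `SU(5)` 0.537, `SU(6)` 0.525) — comparison theorem and instances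
  in the sibling `TwistedBochnerEveryN`.

References: Bakry–Émery LNM 1123 (1985); Bakry–Gentil–Ledoux, Grundlehren 348 (2014) §1.16, C.6 (integrated `Γ₂` criterion);
Shen–Zhu–Zhu CMP 400 (2023) Lemma 4.1, (4.7)–(4.8); the tree's J-SC12/J-SC13, g11's `TwistedBochnerSUN` / `TwistedBochnerSU3`; cell note
`HOME/pub-ymgap-engine-2/TWISTED-BOCHNER-SUN.md`.
-/

noncomputable section

open scoped Matrix ComplexConjugate BigOperators Matrix.Norms.Frobenius ContDiff Topology
open Matrix Complex Finset MeasureTheory ProbabilityTheory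
open Literature.MathematicalPhysics.QuantumFieldTheory
open Literature.MathematicalPhysics.QuantumFieldTheory.SUNBakryEmery
open Summit.QuantumFields.BalabanUV.InfraRed.StrongCouplingSharpTwist (Gam_Gam_left_eq)
open Summit.QuantumFields.BalabanUV.InfraRed.StrongCouplingDimensionalPoincare (poincare_pot_K)
open Summit.QuantumFields.BalabanUV.InfraRed.StrongCouplingDimensionalVariance (var_tilted_le_of_poincare_K)
open Summit.QuantumFields.BalabanUV.InfraRed.StrongCouplingPoincareDoorSUN (OneLinkPoincareSUN)
open Summit.Ventures.YMGap.OneLinkEigen (Lap_pot frobNorm_le_sqrt_mul_matrixOpNorm Gam_pot_pot Gam_pot_one_self_le)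

namespace Summit.Ventures.YMGap.TwistedBochner

variable {N : ℕ}

/-! ### 1. Pointwise inputs for every `N` -/

/-- `L_S S = −(N − 1/N) S + Γ(S,S)` for the one-link weight `S = c Re tr(·B)` on `M_N(ℂ)` (Casimir `N − 1/N`). [folklore] -/
theorem genL_pot_self (hN : N ≠ 0) (c : ℝ) (B Q : Matrix (Fin N) (Fin N) ℂ) :
    genL (pot c B) (pot c B) Q = -(((N : ℝ) - 1 / N) * pot c B Q) + Gam (pot c B) (pot c B) Q := by
  show Lap (pot c B) Q + Gam (pot c B) (pot c B) Q = _
  rw [Lap_pot hN c B]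

/-- **Bessel for the weight**: `Γ(S,S)(g) ≤ c²‖B‖_F²` on `SU(N)` for `S = c Re tr(·B)`. [folklore] -/
theorem Gam_pot_self_le (hN : N ≠ 0) (c : ℝ) (B : Matrix (Fin N) (Fin N) ℂ) (g : SUN N) :
    Gam (pot c B) (pot c B) (g : Matrix (Fin N) (Fin N) ℂ) ≤ c ^ 2 * frobNorm B ^ 2 := by
  have h1 := Gam_pot_one_self_le hN B g
  have e : Gam (pot c B) (pot c B) (g : Matrix (Fin N) (Fin N) ℂ) = c ^ 2 * Gam (pot 1 B) (pot 1 B) (g : Matrix (Fin N) (Fin N) ℂ) := by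
    rw [Gam_pot_pot hN c c B B, Gam_pot_pot hN 1 1 B B]
    ring
  rw [e]
  exact mul_le_mul_of_nonneg_left h1 (sq_nonneg c)

/-- **The Bakry–Émery Hessian bound, every `N`** (Shen–Zhu–Zhu Lemma 4.1): for `S = c Re tr(·B)`, smooth `u`, `g ∈ SU(N)`,
`∑ D_αu D_βu D_αD_βS (g) ≤ |c|‖B‖_op Γ(u,u)(g)` (`H = c Re tr(g Z² B)`, `|Re tr(g Z² B)| ≤ ‖Z‖_F²‖B‖_op`). [cite: arXiv220412737, Lemma 4.1] -/
theorem hess_pot_le_sun (hN : N ≠ 0) (c : ℝ) (B : Matrix (Fin N) (Fin N) ℂ) (u : Matrix (Fin N) (Fin N) ℂ → ℝ) (g : SUN N) :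
    ∑ α, ∑ β, matD (frame α) u (g : Matrix (Fin N) (Fin N) ℂ) * matD (frame β) u (g : Matrix (Fin N) (Fin N) ℂ) *
        matD (frame α) (matD (frame β) (pot c B)) (g : Matrix (Fin N) (Fin N) ℂ) ≤
      -(0 / (N : ℝ)) * (pot c B (g : Matrix (Fin N) (Fin N) ℂ) * Gam u u (g : Matrix (Fin N) (Fin N) ℂ)) +
        |c| * matrixOpNorm B * Gam u u (g : Matrix (Fin N) (Fin N) ℂ) := by
  set Q : Matrix (Fin N) (Fin N) ℂ := (g : Matrix (Fin N) (Fin N) ℂ)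
  have hQ := SUN.mem_unitaryGroup g
  set Z : Matrix (Fin N) (Fin N) ℂ := frameGrad (dirFun u Q)
  have hH : ∑ α, ∑ β, matD (frame α) u Q * matD (frame β) u Q * matD (frame α) (matD (frame β) (pot c B)) Q =
      c * (Q * Z * Z * B).trace.re := sum_sum_hess_potential c B u Q
  have hΓ : Gam u u Q = frobNorm Z ^ 2 := Gam_self_eq_frobNorm_sq hN u Q
  have h1 := abs_re_trace_unitary_mul_mul_mul_le hQ Z B
  have h2 : c * (Q * Z * Z * B).trace.re ≤ |c| * matrixOpNorm B * frobNorm Z ^ 2 := by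
    calc c * (Q * Z * Z * B).trace.re ≤ |c * (Q * Z * Z * B).trace.re| := le_abs_self _
      _ = |c| * |(Q * Z * Z * B).trace.re| := abs_mul _ _
      _ ≤ |c| * (frobNorm Z ^ 2 * matrixOpNorm B) := mul_le_mul_of_nonneg_left h1 (abs_nonneg c)
      _ = |c| * matrixOpNorm B * frobNorm Z ^ 2 := by ring
  rw [hH, hΓ, zero_div, neg_zero, zero_mul, zero_add]
  exact h2

/-! ### 2. The integrated twisted Bochner inequality, every `N ≥ 2`, every twist, every Hessian split -/

/-- **THE INTEGRATED TWISTED BOCHNER INEQUALITY ON `SU(N)`** (every `N ≥ 2`, every twist `θ ≥ 0`, every split `η` and slope `κ`):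
for `S = c Re tr(·B)` and smooth `u`, IF pointwise on `SU(N)` `∑ D_αu D_βu D_αD_βS ≤ −(η/N)·S·Γ(u,u) + κ·Γ(u,u)`, THEN with `n = N² − 1`,
`a_H = 1 − 2(1−θ)/n`, `a_X = θ − (1−θ)/n`:
`(N/2 − a_H κ)∫e^SΓ ≤ (1 − 1/n)∫e^S(L_S u)² + (a_X(N − 1/N) − a_H η/N)∫e^S SΓ + (θ²/2 − a_X)∫e^S Γ(S,S)Γ + (θ²/2 − (1−θ)²/n)∫e^S Γ(S,u)²`.
Proof: `twisted_bochner` times `e^S`, the Hessian word split as `a_H·H + (2(1−θ)/n)(Γ(Γ(S,u),u) − ½Γ(S,Γ(u,u)))` (`Gam_Gam_left_eq`), the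
hypothesis on `a_H·H`, and the three integrations by parts of the tree. [folklore] -/
theorem integral_twisted_bochner (hN : 2 ≤ N) (c : ℝ) (B : Matrix (Fin N) (Fin N) ℂ) {u : Matrix (Fin N) (Fin N) ℂ → ℝ}
    (hu : ContDiff ℝ ∞ u) {θ η κ : ℝ} (hθ : 0 ≤ θ)
    (hH : ∀ g : SUN N,
      ∑ α, ∑ β, matD (frame α) u (g : Matrix (Fin N) (Fin N) ℂ) * matD (frame β) u (g : Matrix (Fin N) (Fin N) ℂ) *
          matD (frame α) (matD (frame β) (pot c B)) (g : Matrix (Fin N) (Fin N) ℂ) ≤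
        -(η / (N : ℝ)) * (pot c B (g : Matrix (Fin N) (Fin N) ℂ) * Gam u u (g : Matrix (Fin N) (Fin N) ℂ)) +
          κ * Gam u u (g : Matrix (Fin N) (Fin N) ℂ)) :
    ((N : ℝ) / 2 - (1 - 2 * (1 - θ) / ((N : ℝ) ^ 2 - 1)) * κ) *
        ∫ g : SUN N, Real.exp (pot c B g) * Gam u u g ∂(haarSU N) ≤
      (1 - 1 / ((N : ℝ) ^ 2 - 1)) * ∫ g : SUN N, Real.exp (pot c B g) * genL (pot c B) u g ^ 2 ∂(haarSU N) +
        ((θ - (1 - θ) / ((N : ℝ) ^ 2 - 1)) * ((N : ℝ) - 1 / N) - (1 - 2 * (1 - θ) / ((N : ℝ) ^ 2 - 1)) * η / N) *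
          ∫ g : SUN N, Real.exp (pot c B g) * (pot c B g * Gam u u g) ∂(haarSU N) +
        (θ ^ 2 / 2 - (θ - (1 - θ) / ((N : ℝ) ^ 2 - 1))) *
          ∫ g : SUN N, Real.exp (pot c B g) * (Gam (pot c B) (pot c B) g * Gam u u g) ∂(haarSU N) +
        (θ ^ 2 / 2 - (1 - θ) ^ 2 / ((N : ℝ) ^ 2 - 1)) *
          ∫ g : SUN N, Real.exp (pot c B g) * Gam (pot c B) u g ^ 2 ∂(haarSU N) := by
  have hN0 : N ≠ 0 := by omega
  have hS : ContDiff ℝ ∞ (pot (N := N) c B) := contDiff_pot c B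
  set n : ℝ := (N : ℝ) ^ 2 - 1 with hn
  set lam : ℝ := (N : ℝ) - 1 / N with hlam
  have hN2 : (2 : ℝ) ≤ N := by exact_mod_cast hN
  have hnpos : 0 < n := by rw [hn]; nlinarith
  set aH : ℝ := 1 - 2 * (1 - θ) / n with haH
  set aX : ℝ := θ - (1 - θ) / n with haX
  have haH0 : 0 ≤ aH := by rw [haH, sub_nonneg, div_le_one hnpos, hn]; nlinarith
  set fΓ : SUN N → ℝ := fun g => Real.exp (pot c B g) * Gam u u g with hfΓ
  set fA : SUN N → ℝ := fun g => Real.exp (pot c B g) * genL (pot c B) u g ^ 2 with hfA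
  set fP : SUN N → ℝ := fun g => Real.exp (pot c B g) * (pot c B g * Gam u u g) with hfP
  set fW : SUN N → ℝ := fun g => Real.exp (pot c B g) * (Gam (pot c B) (pot c B) g * Gam u u g) with hfW
  set fG : SUN N → ℝ := fun g => Real.exp (pot c B g) * Gam (pot c B) u g ^ 2 with hfG
  set fB : SUN N → ℝ := fun g => Real.exp (pot c B g) * Gam2 (pot c B) u g with hfB
  set fX : SUN N → ℝ := fun g => Real.exp (pot c B g) * Gam (pot c B) (Gam u u) g with hfX
  set fLG : SUN N → ℝ := fun g => Real.exp (pot c B g) * (genL (pot c B) u g * Gam (pot c B) u g) with hfLG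
  set fHg : SUN N → ℝ := fun g => Real.exp (pot c B g) * Gam (Gam (pot c B) u) u g with hfHg
  have hwint : ∀ {f : Matrix (Fin N) (Fin N) ℂ → ℝ}, ContDiff ℝ ∞ f →
      Integrable (fun g : SUN N => Real.exp (pot c B g) * f g) (haarSU N) :=
    fun hf => integrable_of_continuous_SUN (continuous_restrict (hS.exp.mul hf)) _
  have hG2c : ContDiff ℝ ∞ (Gam2 (pot (N := N) c B) u) := by
    have e : Gam2 (pot (N := N) c B) u = fun Q => (1 / 2) * genL (pot c B) (Gam u u) Q - Gam u (genL (pot c B) u) Q := rfl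
    rw [e]
    exact (contDiff_const.mul (contDiff_genL hS (contDiff_Gam hu hu))).sub (contDiff_Gam hu (contDiff_genL hS hu))
  have iA : Integrable fA (haarSU N) := hwint (f := fun Q => genL (pot c B) u Q ^ 2) ((contDiff_genL hS hu).pow 2)
  have iΓ : Integrable fΓ (haarSU N) := hwint (contDiff_Gam hu hu)
  have iP : Integrable fP (haarSU N) := hwint (f := fun Q => pot c B Q * Gam u u Q) (hS.mul (contDiff_Gam hu hu))
  have iW : Integrable fW (haarSU N) :=
    hwint (f := fun Q => Gam (pot c B) (pot c B) Q * Gam u u Q) ((contDiff_Gam hS hS).mul (contDiff_Gam hu hu))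
  have iG : Integrable fG (haarSU N) := hwint (f := fun Q => Gam (pot c B) u Q ^ 2) ((contDiff_Gam hS hu).pow 2)
  have iB : Integrable fB (haarSU N) := hwint hG2c
  have iX : Integrable fX (haarSU N) := hwint (contDiff_Gam hS (contDiff_Gam hu hu))
  have iLG : Integrable fLG (haarSU N) :=
    hwint (f := fun Q => genL (pot c B) u Q * Gam (pot c B) u Q) ((contDiff_genL hS hu).mul (contDiff_Gam hS hu))
  have iHg : Integrable fHg (haarSU N) := hwint (contDiff_Gam (contDiff_Gam hS hu) hu)
  have h0 : ∫ g, fA g ∂(haarSU N) = ∫ g, fB g ∂(haarSU N) := integral_exp_mul_genL_sq hN0 hS hu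
  have h1 : ∫ g, fX g ∂(haarSU N) = lam * ∫ g, fP g ∂(haarSU N) - ∫ g, fW g ∂(haarSU N) := by
    have h := integral_mul_exp_mul_genL hN0 hS (contDiff_Gam hu hu) hS
    have e : ∀ g : SUN N, Gam u u g * (Real.exp (pot c B g) * genL (pot c B) (pot c B) g) = -(lam * fP g) + fW g := fun g => by
      rw [genL_pot_self hN0, hfP, hfW]; ring
    have e' : ∀ g : SUN N, Real.exp (pot c B g) * Gam (Gam u u) (pot c B) g = fX g := fun g => by rw [Gam_comm (Gam u u) (pot c B)]
    simp_rw [e, e'] at h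
    have iPn : Integrable (fun g : SUN N => -(lam * fP g)) (haarSU N) := (iP.const_mul lam).neg
    rw [integral_add iPn iW, integral_neg, integral_const_mul] at h
    linarith
  have h2 : ∫ g, fLG g ∂(haarSU N) = -∫ g, fHg g ∂(haarSU N) := by
    have h := integral_mul_exp_mul_genL hN0 hS (contDiff_Gam hS hu) hu
    have e : ∀ g : SUN N, Gam (pot c B) u g * (Real.exp (pot c B g) * genL (pot c B) u g) = fLG g := fun g => by rw [hfLG]; ring
    simp_rw [e] at h
    exact h
  have hpt : ∀ g : SUN N, ((N : ℝ) / 2 - aH * κ) * fΓ g ≤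
      fB g + (2 * (1 - θ) / n) * fHg g + (2 * (1 - θ) / n) * fLG g + aX * fX g + (θ ^ 2 / 2) * fW g +
        (θ ^ 2 / 2 - (1 - θ) ^ 2 / n) * fG g - (1 / n) * fA g - (aH * η / N) * fP g := by
    intro g
    have hT := twisted_bochner hN0 hS hu θ (g : Matrix (Fin N) (Fin N) ℂ)
    have hE := mul_le_mul_of_nonneg_left (hH g) haH0
    have hL := Gam_Gam_left_eq hN0 hS hu (g : Matrix (Fin N) (Fin N) ℂ)
    have hw : 0 < Real.exp (pot c B g) := Real.exp_pos _
    simp only [hfΓ, hfB, hfHg, hfLG, hfX, hfW, hfG, hfA, hfP]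
    set w := Real.exp (pot c B g)
    set Γ := Gam u u (g : Matrix (Fin N) (Fin N) ℂ)
    set A := genL (pot c B) u (g : Matrix (Fin N) (Fin N) ℂ)
    set G := Gam (pot c B) u (g : Matrix (Fin N) (Fin N) ℂ)
    set W := Gam (pot c B) (pot c B) (g : Matrix (Fin N) (Fin N) ℂ)
    set X := Gam (pot c B) (Gam u u) (g : Matrix (Fin N) (Fin N) ℂ)
    set Hg := Gam (Gam (pot c B) u) u (g : Matrix (Fin N) (Fin N) ℂ)
    set G2 := Gam2 (pot c B) u (g : Matrix (Fin N) (Fin N) ℂ)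
    set P := pot c B (g : Matrix (Fin N) (Fin N) ℂ)
    set H := ∑ α, ∑ β, matD (frame α) u (g : Matrix (Fin N) (Fin N) ℂ) * matD (frame β) u (g : Matrix (Fin N) (Fin N) ℂ) *
        matD (frame α) (matD (frame β) (pot c B)) (g : Matrix (Fin N) (Fin N) ℂ)
    have hHsplit : H = aH * H + (2 * (1 - θ) / n) * (Hg - (1 / 2) * X) := by rw [hL, haH]; field_simp; ring
    have hdim : (1 / n) * (A - (1 - θ) * G) ^ 2 = (1 / n) * A ^ 2 - (2 * (1 - θ) / n) * (A * G) + ((1 - θ) ^ 2 / n) * G ^ 2 := by ring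
    have hcomb : ((N : ℝ) / 2 - aH * κ) * Γ ≤
        G2 + (2 * (1 - θ) / n) * Hg + (2 * (1 - θ) / n) * (A * G) + aX * X + (θ ^ 2 / 2) * (W * Γ) +
          (θ ^ 2 / 2 - (1 - θ) ^ 2 / n) * G ^ 2 - (1 / n) * A ^ 2 - (aH * η / N) * (P * Γ) := by
      have hT' : (N : ℝ) / 2 * Γ + (1 / n) * (A - (1 - θ) * G) ^ 2 + θ ^ 2 / 2 * (W * Γ - G ^ 2) ≤
          G2 + H + θ * X + θ ^ 2 * (W * Γ) := hT
      rw [hdim] at hT'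
      have hE' : aH * H ≤ aH * (-(η / (N : ℝ)) * (P * Γ) + κ * Γ) := hE
      rw [← sub_nonneg]
      have key := add_nonneg (sub_nonneg.2 hT') (sub_nonneg.2 hE')
      refine key.trans_eq ?_
      rw [haX]
      linear_combination hHsplit
    have h' := mul_le_mul_of_nonneg_left hcomb hw.le
    calc ((N : ℝ) / 2 - aH * κ) * (w * Γ) = w * (((N : ℝ) / 2 - aH * κ) * Γ) := by ring
      _ ≤ _ := h'
      _ = _ := by ring
  have iR1 : Integrable (fun g => fB g + (2 * (1 - θ) / n) * fHg g) (haarSU N) := iB.add (iHg.const_mul _)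
  have iR2 : Integrable (fun g => fB g + (2 * (1 - θ) / n) * fHg g + (2 * (1 - θ) / n) * fLG g) (haarSU N) :=
    iR1.add (iLG.const_mul _)
  have iR3 : Integrable (fun g => fB g + (2 * (1 - θ) / n) * fHg g + (2 * (1 - θ) / n) * fLG g + aX * fX g) (haarSU N) :=
    iR2.add (iX.const_mul _)
  have iR4 : Integrable (fun g => fB g + (2 * (1 - θ) / n) * fHg g + (2 * (1 - θ) / n) * fLG g + aX * fX g +
      (θ ^ 2 / 2) * fW g) (haarSU N) := iR3.add (iW.const_mul _)
  have iR5 : Integrable (fun g => fB g + (2 * (1 - θ) / n) * fHg g + (2 * (1 - θ) / n) * fLG g + aX * fX g +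
      (θ ^ 2 / 2) * fW g + (θ ^ 2 / 2 - (1 - θ) ^ 2 / n) * fG g) (haarSU N) := iR4.add (iG.const_mul _)
  have iR6 : Integrable (fun g => fB g + (2 * (1 - θ) / n) * fHg g + (2 * (1 - θ) / n) * fLG g + aX * fX g +
      (θ ^ 2 / 2) * fW g + (θ ^ 2 / 2 - (1 - θ) ^ 2 / n) * fG g - (1 / n) * fA g) (haarSU N) := iR5.sub (iA.const_mul _)
  have iR7 : Integrable (fun g => fB g + (2 * (1 - θ) / n) * fHg g + (2 * (1 - θ) / n) * fLG g + aX * fX g +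
      (θ ^ 2 / 2) * fW g + (θ ^ 2 / 2 - (1 - θ) ^ 2 / n) * fG g - (1 / n) * fA g - (aH * η / N) * fP g) (haarSU N) :=
    iR6.sub (iP.const_mul _)
  have iL : Integrable (fun g => ((N : ℝ) / 2 - aH * κ) * fΓ g) (haarSU N) := iΓ.const_mul _
  have hm := integral_mono iL iR7 hpt
  rw [integral_sub iR6 (iP.const_mul _), integral_sub iR5 (iA.const_mul _), integral_add iR4 (iG.const_mul _),
    integral_add iR3 (iW.const_mul _), integral_add iR2 (iX.const_mul _), integral_add iR1 (iLG.const_mul _),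
    integral_add iB (iHg.const_mul _), integral_const_mul, integral_const_mul, integral_const_mul, integral_const_mul,
    integral_const_mul, integral_const_mul, integral_const_mul, integral_const_mul, ← h0, h2, h1] at hm
  exact hm.trans_eq (by ring)

/-! ### 3. The instance `θ = 1/N²`, no split: a one-link Poincaré constant beyond Bakry–Émery for EVERY `N ≥ 2` -/

/-- **THE EVERY-`N` INTEGRATED TWISTED INEQUALITY**: for `N ≥ 2`, `S = c Re tr(·B)` with ANY `c ∈ ℝ`, `B ∈ M_N(ℂ)` and every smooth `u`,
`((N²−1)/(N²−2))·(N/2 − (1 − 2/N²)|c|‖B‖_op − c²‖B‖_F²/(2N⁴)) ∫e^S Γ(u,u) dσ ≤ ∫e^S (L_S u)² dσ`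
(`integral_twisted_bochner` at `θ = 1/N²`, `η = 0`, `κ = |c|‖B‖_op`: the `SΓ` words cancel, the `Γ(S,u)²` slack is dropped, `Γ(S,S) ≤ c²‖B‖_F²`).
Bakry–Émery (`integral_exp_mul_Gam_le`): `N/2 − |c|‖B‖_op`. [folklore] -/
theorem integral_exp_mul_Gam_le_twisted_sun (hN : 2 ≤ N) (c : ℝ) (B : Matrix (Fin N) (Fin N) ℂ)
    {u : Matrix (Fin N) (Fin N) ℂ → ℝ} (hu : ContDiff ℝ ∞ u) :
    ((N : ℝ) ^ 2 - 1) / ((N : ℝ) ^ 2 - 2) *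
          ((N : ℝ) / 2 - (1 - 2 / (N : ℝ) ^ 2) * (|c| * matrixOpNorm B) - c ^ 2 * frobNorm B ^ 2 / (2 * (N : ℝ) ^ 4)) *
        ∫ g : SUN N, Real.exp (pot c B g) * Gam u u g ∂(haarSU N) ≤
      ∫ g : SUN N, Real.exp (pot c B g) * genL (pot c B) u g ^ 2 ∂(haarSU N) := by
  have hN0 : N ≠ 0 := by omega
  have hN2 : (2 : ℝ) ≤ N := by exact_mod_cast hN
  have hNne : (N : ℝ) ≠ 0 := by positivity
  have hn1 : (N : ℝ) ^ 2 - 1 ≠ 0 := by nlinarith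
  have hn2 : 0 < (N : ℝ) ^ 2 - 2 := by nlinarith
  have hS : ContDiff ℝ ∞ (pot (N := N) c B) := contDiff_pot c B
  have h := integral_twisted_bochner hN c B hu (θ := 1 / (N : ℝ) ^ 2) (η := 0) (κ := |c| * matrixOpNorm B) (by positivity)
    (hess_pot_le_sun hN0 c B u)
  have eP : (1 / (N : ℝ) ^ 2 - (1 - 1 / (N : ℝ) ^ 2) / ((N : ℝ) ^ 2 - 1)) * ((N : ℝ) - 1 / N) -
      (1 - 2 * (1 - 1 / (N : ℝ) ^ 2) / ((N : ℝ) ^ 2 - 1)) * 0 / N = 0 := by field_simp; ring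
  have eW : (1 / (N : ℝ) ^ 2) ^ 2 / 2 - (1 / (N : ℝ) ^ 2 - (1 - 1 / (N : ℝ) ^ 2) / ((N : ℝ) ^ 2 - 1)) = 1 / (2 * (N : ℝ) ^ 4) := by
    field_simp; ring
  have eG : (1 / (N : ℝ) ^ 2) ^ 2 / 2 - (1 - 1 / (N : ℝ) ^ 2) ^ 2 / ((N : ℝ) ^ 2 - 1) = (3 - 2 * (N : ℝ) ^ 2) / (2 * (N : ℝ) ^ 4) := by
    field_simp; ring
  have eH : 1 - 2 * (1 - 1 / (N : ℝ) ^ 2) / ((N : ℝ) ^ 2 - 1) = 1 - 2 / (N : ℝ) ^ 2 := by field_simp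
  have eA : 1 - 1 / ((N : ℝ) ^ 2 - 1) = ((N : ℝ) ^ 2 - 2) / ((N : ℝ) ^ 2 - 1) := by field_simp; ring
  rw [eP, eW, eG, eH, eA, zero_mul, add_zero] at h
  set IΓ := ∫ g : SUN N, Real.exp (pot c B g) * Gam u u g ∂(haarSU N) with hIΓ
  set IA := ∫ g : SUN N, Real.exp (pot c B g) * genL (pot c B) u g ^ 2 ∂(haarSU N) with hIA
  set IW := ∫ g : SUN N, Real.exp (pot c B g) * (Gam (pot c B) (pot c B) g * Gam u u g) ∂(haarSU N) with hIW
  set IG := ∫ g : SUN N, Real.exp (pot c B g) * Gam (pot c B) u g ^ 2 ∂(haarSU N) with hIG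
  have iΓ : Integrable (fun g : SUN N => Real.exp (pot c B g) * Gam u u g) (haarSU N) :=
    integrable_of_continuous_SUN (continuous_restrict (hS.exp.mul (contDiff_Gam hu hu))) _
  have iW : Integrable (fun g : SUN N => Real.exp (pot c B g) * (Gam (pot c B) (pot c B) g * Gam u u g)) (haarSU N) :=
    integrable_of_continuous_SUN (continuous_restrict (hS.exp.mul ((contDiff_Gam hS hS).mul (contDiff_Gam hu hu)))) _
  have hWle : IW ≤ c ^ 2 * frobNorm B ^ 2 * IΓ := by
    rw [hIW, hIΓ, ← integral_const_mul]
    refine integral_mono iW (iΓ.const_mul _) fun g => ?_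
    have hw : 0 < Real.exp (pot c B g) := Real.exp_pos _
    have hΓ0 : 0 ≤ Gam u u (g : Matrix (Fin N) (Fin N) ℂ) := Gam_self_nonneg _ _
    have hb := Gam_pot_self_le hN0 c B g
    calc Real.exp (pot c B g) * (Gam (pot c B) (pot c B) g * Gam u u g)
        ≤ Real.exp (pot c B g) * (c ^ 2 * frobNorm B ^ 2 * Gam u u g) :=
          mul_le_mul_of_nonneg_left (mul_le_mul_of_nonneg_right hb hΓ0) hw.le
      _ = c ^ 2 * frobNorm B ^ 2 * (Real.exp (pot c B g) * Gam u u g) := by ring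
  have hG0 : 0 ≤ IG := integral_nonneg fun g => mul_nonneg (Real.exp_pos _).le (sq_nonneg _)
  have hΓ0 : 0 ≤ IΓ := integral_nonneg fun g => mul_nonneg (Real.exp_pos _).le (Gam_self_nonneg _ _)
  have t1 : 1 / (2 * (N : ℝ) ^ 4) * IW ≤ 1 / (2 * (N : ℝ) ^ 4) * (c ^ 2 * frobNorm B ^ 2 * IΓ) :=
    mul_le_mul_of_nonneg_left hWle (by positivity)
  have t2 : (3 - 2 * (N : ℝ) ^ 2) / (2 * (N : ℝ) ^ 4) * IG ≤ 0 :=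
    mul_nonpos_of_nonpos_of_nonneg (div_nonpos_of_nonpos_of_nonneg (by nlinarith) (by positivity)) hG0
  have h3 : ((N : ℝ) / 2 - (1 - 2 / (N : ℝ) ^ 2) * (|c| * matrixOpNorm B) - c ^ 2 * frobNorm B ^ 2 / (2 * (N : ℝ) ^ 4)) * IΓ ≤
      ((N : ℝ) ^ 2 - 2) / ((N : ℝ) ^ 2 - 1) * IA := by
    have e : ((N : ℝ) / 2 - (1 - 2 / (N : ℝ) ^ 2) * (|c| * matrixOpNorm B) - c ^ 2 * frobNorm B ^ 2 / (2 * (N : ℝ) ^ 4)) * IΓ =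
        ((N : ℝ) / 2 - (1 - 2 / (N : ℝ) ^ 2) * (|c| * matrixOpNorm B)) * IΓ - 1 / (2 * (N : ℝ) ^ 4) * (c ^ 2 * frobNorm B ^ 2 * IΓ) := by
      ring
    rw [e]
    linarith [h, t1, t2]
  have hr : 0 < ((N : ℝ) ^ 2 - 1) / ((N : ℝ) ^ 2 - 2) := div_pos (by nlinarith) hn2
  calc ((N : ℝ) ^ 2 - 1) / ((N : ℝ) ^ 2 - 2) *
          ((N : ℝ) / 2 - (1 - 2 / (N : ℝ) ^ 2) * (|c| * matrixOpNorm B) - c ^ 2 * frobNorm B ^ 2 / (2 * (N : ℝ) ^ 4)) * IΓ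
      = ((N : ℝ) ^ 2 - 1) / ((N : ℝ) ^ 2 - 2) *
          (((N : ℝ) / 2 - (1 - 2 / (N : ℝ) ^ 2) * (|c| * matrixOpNorm B) - c ^ 2 * frobNorm B ^ 2 / (2 * (N : ℝ) ^ 4)) * IΓ) := by
        ring
    _ ≤ ((N : ℝ) ^ 2 - 1) / ((N : ℝ) ^ 2 - 2) * (((N : ℝ) ^ 2 - 2) / ((N : ℝ) ^ 2 - 1) * IA) := mul_le_mul_of_nonneg_left h3 hr.le
    _ = IA := by
        field_simp

/-- **The twisted one-link variance bound on `SU(N)`, every `N ≥ 2`** (hypothesis-free): for `B ∈ M_N(ℂ)`, every `0 < K` with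
`K ≤ ((N²−1)/(N²−2))·(N/2 − (N − 2/N)‖B‖_op − ‖B‖_F²/(2N²))`, and every `M`-Lipschitz `ψ`:  `Var_{ν_B}(ψ) ≤ M²/K`,
`ν_B(dg) ∝ exp(N Re tr(gB)) dg` (the integrated inequality at `c = N` fed into J-SC12's `poincare_pot_K` / `var_tilted_le_of_poincare_K`). [folklore] -/
theorem suN_var_tilted_le_twisted (hN : 2 ≤ N) (B : Matrix (Fin N) (Fin N) ℂ) {K : ℝ} (hK : 0 < K)
    (hKle : K ≤ ((N : ℝ) ^ 2 - 1) / ((N : ℝ) ^ 2 - 2) *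
      ((N : ℝ) / 2 - ((N : ℝ) - 2 / N) * matrixOpNorm B - frobNorm B ^ 2 / (2 * (N : ℝ) ^ 2)))
    (ψ : Matrix.specialUnitaryGroup (Fin N) ℂ → ℝ) (M : ℝ) (hM : 0 ≤ M)
    (hψ : ∀ a b, |ψ a - ψ b| ≤ M * suFrobDist a b) :
    Var[ψ; (haarProbability (Matrix.specialUnitaryGroup (Fin N) ℂ)).tilted
        fun g => (N : ℝ) * ((g : Matrix (Fin N) (Fin N) ℂ) * B).trace.re] ≤ M ^ 2 / K := by
  have hN0 : N ≠ 0 := by omega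
  have hN2 : (2 : ℝ) ≤ N := by exact_mod_cast hN
  have hNne : (N : ℝ) ≠ 0 := by positivity
  have hc : |(N : ℝ)| = N := abs_of_nonneg (by positivity)
  have hGam : ∀ {v : Matrix (Fin N) (Fin N) ℂ → ℝ}, ContDiff ℝ ∞ v →
      K * ∫ g : SUN N, Real.exp (pot (N : ℝ) B g) * Gam v v g ∂(haarSU N) ≤
        ∫ g : SUN N, Real.exp (pot (N : ℝ) B g) * genL (pot (N : ℝ) B) v g ^ 2 ∂(haarSU N) := by
    intro v hv
    have h := integral_exp_mul_Gam_le_twisted_sun hN (N : ℝ) B hv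
    rw [hc] at h
    have hI : 0 ≤ ∫ g : SUN N, Real.exp (pot (N : ℝ) B g) * Gam v v g ∂(haarSU N) :=
      integral_nonneg fun g => mul_nonneg (Real.exp_pos _).le (Gam_self_nonneg _ _)
    have hKle' : K ≤ ((N : ℝ) ^ 2 - 1) / ((N : ℝ) ^ 2 - 2) *
        ((N : ℝ) / 2 - (1 - 2 / (N : ℝ) ^ 2) * ((N : ℝ) * matrixOpNorm B) - (N : ℝ) ^ 2 * frobNorm B ^ 2 / (2 * (N : ℝ) ^ 4)) := by
      have e : (1 - 2 / (N : ℝ) ^ 2) * ((N : ℝ) * matrixOpNorm B) = ((N : ℝ) - 2 / N) * matrixOpNorm B := by field_simp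
      have e' : (N : ℝ) ^ 2 * frobNorm B ^ 2 / (2 * (N : ℝ) ^ 4) = frobNorm B ^ 2 / (2 * (N : ℝ) ^ 2) := by field_simp
      rw [e, e']
      exact hKle
    exact (mul_le_mul_of_nonneg_right hKle' hI).trans h
  have hP : ∀ {F : Matrix (Fin N) (Fin N) ℂ → ℝ}, ContDiff ℝ ∞ F →
      K * ∫ g : SUN N, Real.exp (pot (N : ℝ) B g) * (F g -
          (∫ g : SUN N, Real.exp (pot (N : ℝ) B g) * F g ∂(haarSU N)) /
            (∫ g : SUN N, Real.exp (pot (N : ℝ) B g) ∂(haarSU N))) ^ 2 ∂(haarSU N) ≤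
        ∫ g : SUN N, Real.exp (pot (N : ℝ) B g) * Gam F F g ∂(haarSU N) :=
    fun hF => poincare_pot_K hN0 (N : ℝ) B hK hGam hF
  exact var_tilted_le_of_poincare_K hN0 B hK hP ψ M hM hψ

/-- **`OneLinkPoincareSUN N R (1/K)` FOR EVERY `N ≥ 2` — the twisted one-link Poincaré constant** (hypothesis-free): whenever `0 < K` and
`K + ((N²−1)/N)·R + ((N²−1)/(2N(N²−2)))·R² ≤ N(N²−1)/(2(N²−2))`, on the operator-norm ball `‖B‖_op ≤ R` every `M`-Lipschitz `ψ` has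
`Var_{ν_B}(ψ) ≤ M²/K` (`‖B‖_F² ≤ N‖B‖_op²`).  Bakry–Émery (`oneLinkPoincareSUN_bakryEmery`): `K = N(1/2 − R)`, `R < 1/2` only; here the radius
cap is `√((N²−2)² + N²) − (N²−2) > 1/2`.  For `N = 3` g11's `oneLinkPoincareSUN_su3_twisted` is better, for `N = 2` J-SC13 is sharp. [folklore] -/
theorem oneLinkPoincareSUN_twisted (hN : 2 ≤ N) {R K : ℝ} (hK : 0 < K)
    (hKR : K + ((N : ℝ) ^ 2 - 1) / N * R + ((N : ℝ) ^ 2 - 1) / (2 * N * ((N : ℝ) ^ 2 - 2)) * R ^ 2 ≤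
      (N : ℝ) * ((N : ℝ) ^ 2 - 1) / (2 * ((N : ℝ) ^ 2 - 2))) :
    OneLinkPoincareSUN N R (1 / K) := by
  intro B hB ψ M hM hψ
  have hN2 : (2 : ℝ) ≤ N := by exact_mod_cast hN
  have hNpos : (0 : ℝ) < N := by positivity
  have hn2 : 0 < (N : ℝ) ^ 2 - 2 := by nlinarith
  have hop : 0 ≤ matrixOpNorm B := matrixOpNorm_nonneg B
  have hF : frobNorm B ^ 2 ≤ (N : ℝ) * matrixOpNorm B ^ 2 := by
    have h := frobNorm_le_sqrt_mul_matrixOpNorm B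
    have h' := pow_le_pow_left₀ (frobNorm_nonneg B) h 2
    rw [mul_pow, Real.sq_sqrt hNpos.le] at h'
    exact h'
  have hF' : frobNorm B ^ 2 ≤ (N : ℝ) * R ^ 2 :=
    hF.trans (mul_le_mul_of_nonneg_left (pow_le_pow_left₀ hop hB 2) hNpos.le)
  have hKle : K ≤ ((N : ℝ) ^ 2 - 1) / ((N : ℝ) ^ 2 - 2) *
      ((N : ℝ) / 2 - ((N : ℝ) - 2 / N) * matrixOpNorm B - frobNorm B ^ 2 / (2 * (N : ℝ) ^ 2)) := by
    have hc1 : 0 ≤ (N : ℝ) - 2 / N := by rw [sub_nonneg, div_le_iff₀ hNpos]; nlinarith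
    have hmono : (N : ℝ) / 2 - ((N : ℝ) - 2 / N) * R - (N : ℝ) * R ^ 2 / (2 * (N : ℝ) ^ 2) ≤
        (N : ℝ) / 2 - ((N : ℝ) - 2 / N) * matrixOpNorm B - frobNorm B ^ 2 / (2 * (N : ℝ) ^ 2) := by
      have h1 : ((N : ℝ) - 2 / N) * matrixOpNorm B ≤ ((N : ℝ) - 2 / N) * R := mul_le_mul_of_nonneg_left hB hc1
      have h2 : frobNorm B ^ 2 / (2 * (N : ℝ) ^ 2) ≤ (N : ℝ) * R ^ 2 / (2 * (N : ℝ) ^ 2) :=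
        div_le_div_of_nonneg_right hF' (by positivity)
      linarith
    have hr : 0 ≤ ((N : ℝ) ^ 2 - 1) / ((N : ℝ) ^ 2 - 2) := div_nonneg (by nlinarith) hn2.le
    have e : ((N : ℝ) ^ 2 - 1) / ((N : ℝ) ^ 2 - 2) * ((N : ℝ) / 2 - ((N : ℝ) - 2 / N) * R - (N : ℝ) * R ^ 2 / (2 * (N : ℝ) ^ 2)) =
        (N : ℝ) * ((N : ℝ) ^ 2 - 1) / (2 * ((N : ℝ) ^ 2 - 2)) - ((N : ℝ) ^ 2 - 1) / N * R -
          ((N : ℝ) ^ 2 - 1) / (2 * N * ((N : ℝ) ^ 2 - 2)) * R ^ 2 := by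
      field_simp
    calc K ≤ (N : ℝ) * ((N : ℝ) ^ 2 - 1) / (2 * ((N : ℝ) ^ 2 - 2)) - ((N : ℝ) ^ 2 - 1) / N * R -
          ((N : ℝ) ^ 2 - 1) / (2 * N * ((N : ℝ) ^ 2 - 2)) * R ^ 2 := by linarith
      _ = ((N : ℝ) ^ 2 - 1) / ((N : ℝ) ^ 2 - 2) * ((N : ℝ) / 2 - ((N : ℝ) - 2 / N) * R - (N : ℝ) * R ^ 2 / (2 * (N : ℝ) ^ 2)) := e.symm
      _ ≤ _ := mul_le_mul_of_nonneg_left hmono hr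
  have h := suN_var_tilted_le_twisted hN B hK hKle ψ M hM hψ
  calc Var[ψ; (haarProbability (Matrix.specialUnitaryGroup (Fin N) ℂ)).tilted
          fun g => (N : ℝ) * ((g : Matrix (Fin N) (Fin N) ℂ) * B).trace.re] ≤ M ^ 2 / K := h
    _ = 1 / K * M ^ 2 := by ring

end Summit.Ventures.YMGap.TwistedBochner

end
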